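import Summits.BirchSwinnertonDyer.BirchSwinnertonDyer.Theorems.PrintCf2SplitBadTwoRestrictedSelmerPairBase
import HarnessLib

/-!
# Crux `PrintCf2.SplitBadTwoRankOneOfFacts` (stmt-BirchSwinnertonDyer-20368), road α v10.3, S3c factor (F3), GLOBAL half:
# THE UNIFORM BOUND ON GLOBAL CLASSES FROM THE FINITENESS OF A RESTRICTED SELMER GROUP (pure counting in `H¹(Γ_K, M)`)

Cell `bsd-print-cf2`, width seat `bsd-line-cf2-p1-w2` g11; `--supports stmt-BirchSwinnertonDyer-20368` (helper, Theses-free).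
HONEST FRAMING: nothing here closes a crux or a stub; BSD is not proved by any of this; no summit statement is proved by this seat.
No definition, no named fact, no `sorry`, no kit. beyond-print theorem: no (bookkeeping).

WHY (memo `Cruxes/SplitBadTwoRankOneOfFacts/F3-GLOBAL-w2g11.md` §2). The lower bound of (F3) needs a UNIFORM bound on the index of the
Kummer line `Λ_M` in the dual-side group `G′_M` (the `W*′`-component of `(𝓕*_M).sel`, -w4 g9's Option A‴). Its image `Z = ι′_{M,*}(G′_M)` in
`H¹(Γ_K, W*′)` vanishes at every finite `w ∤ 2` off the finite set `T = {w ∣ 7d}` and at the infinite places, and its restriction to `D_v` is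
small (`≤ 2^M · #W*′(K_v)`). THIS FILE: for ANY subgroup `Z ≤ H¹(⊤, M)` vanishing at the finite `w ∤ p` off `T` and at `∞`, the kernel of
`Z → H¹(D_v, M) × ∏_{w ∈ T} H¹(D_w, M)` lies in Agboola's restricted group `𝔖_v(K, M) = restrictedSelmerBase M p v` (strict at `v`, trivial at
every `w ∤ p` and at `∞`, no condition at the other places above `p`), so
* `finite_of_restrictedSelmerBase_of_map` — `Z` is finite as soon as `𝔖_v(K,M)`, `Z.map loc_v` and the `H¹(D_w, M)` (`w ∈ T`) are;
* **`natCard_le_of_restrictedSelmerBase_of_map`** — `#Z ≤ #𝔖_v(K, M) · #(Z.map loc_v) · ∏_{w ∈ T} #H¹(D_w, M)`.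
On the S3c frame (`M = W*′`, `p = 2`, hfinB′ = -w2 g10 `ConjTransport.finite_restrictedSelmerBase_conj_of_finite`): `#G′_M ≤ 2 · #Z ≤ 2^{M+1} · B`,
`B = #𝔖_v(K,W*′) · #W*′(K_v) · ∏_{w∣7d} #H¹(D_w, W*′)` — the «rank one» input of (F3) from S3b′'s bottom finiteness alone.

References: A. Agboola, Compositio 143 (2007) §3, §6 [Agboola2007]; J. S. Milne, *ADT* (2006) I Thm. 4.10 [MilneADT2006].
-/

noncomputable section

open scoped Classical

set_option linter.dupNamespace false -- `Summit.BirchSwinnertonDyer.BirchSwinnertonDyer` (summit = problem) is the tree's layout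
set_option autoImplicit false

open NumberField IsDedekindDomain Field
open Literature.NumberTheory.EllipticCurves Literature.NumberTheory.EllipticCurves.GreenbergSelmer
open Literature.NumberTheory.EllipticCurves.Agboola2007
open Literature.NumberTheory.GaloisRepresentations

universe u

namespace Summit.BirchSwinnertonDyer.BirchSwinnertonDyer.Theorems.PrintCf2.RestrictedSelmerPair

section Bound

variable {K : Type u} [Field K] [NumberField K] (M : Type u) [AddCommGroup M]
  [DistribMulAction (absoluteGaloisGroup K) M] [TopologicalSpace M] [DiscreteTopology M]
  (p : ℕ) (v : HeightOneSpectrum (𝓞 K)) (T : Finset (HeightOneSpectrum (𝓞 K)))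
  (Z : AddSubgroup (subgroupH1 (⊤ : Subgroup (absoluteGaloisGroup K)) M))

/-- **The kernel of the probe lies in `𝔖_v(K, M)`**: a class of `Z` (vanishing at the finite `w ∤ p` off `T` and at `∞`) which also vanishes
on `D_v` and on the `D_w`, `w ∈ T`, lies in Agboola's restricted Selmer group `restrictedSelmerBase M p v`.
[cite: Agboola2007, §3 (arXiv p0008:L58–64), §6 (p0013:L1–4)] -/
theorem mem_restrictedSelmerBase_of_probe_eq_zero
    (hT : ∀ z ∈ Z, ∀ w : HeightOneSpectrum (𝓞 K), ((p : ℕ) : 𝓞 K) ∉ w.asIdeal → w ∉ T →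
      resOfLe M (inf_le_left : ⊤ ⊓ decomp w ≤ ⊤) z = 0)
    (hinf : ∀ z ∈ Z, ∀ w : InfinitePlace K, resOfLe M (inf_le_left : ⊤ ⊓ decompInf w ≤ ⊤) z = 0)
    {z : subgroupH1 (⊤ : Subgroup (absoluteGaloisGroup K)) M} (hz : z ∈ Z)
    (hv : resOfLe M (inf_le_left : ⊤ ⊓ decomp v ≤ ⊤) z = 0)
    (hw : ∀ w ∈ T, resOfLe M (inf_le_left : ⊤ ⊓ decomp w ≤ ⊤) z = 0) :
    z ∈ restrictedSelmerBase M p v := by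
  rw [mem_restrictedSelmerBase_iff_resOfLe]
  refine ⟨fun w hpw ↦ ?_, hinf z hz, hv⟩
  by_cases hwT : w ∈ T
  · exact hw w hwT
  · exact hT z hz w hpw hwT

/-- **Finiteness from a finite restricted Selmer group.** If `𝔖_v(K, M)`, the image `Z.map loc_v` and the local groups `H¹(D_w, M)` (`w ∈ T`)
are finite, then so is every `Z ≤ H¹(Γ_K, M)` vanishing at the finite `w ∤ p` off `T` and at `∞`. [cite: Agboola2007, §6 Prop. 6.10–6.11] -/
theorem finite_of_restrictedSelmerBase_of_map
    (hT : ∀ z ∈ Z, ∀ w : HeightOneSpectrum (𝓞 K), ((p : ℕ) : 𝓞 K) ∉ w.asIdeal → w ∉ T →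
      resOfLe M (inf_le_left : ⊤ ⊓ decomp w ≤ ⊤) z = 0)
    (hinf : ∀ z ∈ Z, ∀ w : InfinitePlace K, resOfLe M (inf_le_left : ⊤ ⊓ decompInf w ≤ ⊤) z = 0)
    [Finite (restrictedSelmerBase M p v)]
    [Finite (Z.map (resOfLe M (inf_le_left : ⊤ ⊓ decomp v ≤ ⊤)))]
    (hfinT : ∀ w ∈ T, Finite (subgroupH1 (⊤ ⊓ decomp w) M)) :
    Finite ↥Z := by
  set Φ : ↥Z →+ subgroupH1 (⊤ ⊓ decomp v) M ×
      ((w : ↥T) → subgroupH1 (⊤ ⊓ decomp (w : HeightOneSpectrum (𝓞 K))) M) :=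
    AddMonoidHom.prod ((resOfLe M (inf_le_left : ⊤ ⊓ decomp v ≤ ⊤)).comp Z.subtype)
      (AddMonoidHom.pi fun w : ↥T ↦
        (resOfLe M (inf_le_left : ⊤ ⊓ decomp (w : HeightOneSpectrum (𝓞 K)) ≤ ⊤)).comp Z.subtype) with hΦ
  -- the kernel embeds in `𝔖_v(K, M)`
  have hker : Finite Φ.ker := by
    let j : Φ.ker → restrictedSelmerBase M p v := fun z ↦ ⟨((z : ↥Z) : subgroupH1 ⊤ M), by
      have hz0 : Φ (z : ↥Z) = 0 := (AddMonoidHom.mem_ker).mp z.2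
      refine mem_restrictedSelmerBase_of_probe_eq_zero M p v T Z hT hinf (z : ↥Z).2 ?_ (fun w hw ↦ ?_)
      · exact congrArg Prod.fst hz0
      · exact congrArg (fun q ↦ q.2 ⟨w, hw⟩) hz0⟩
    have hj : Function.Injective j := by
      intro a b hab
      apply Subtype.ext; apply Subtype.ext
      exact congrArg (fun q : ↥(restrictedSelmerBase M p v) ↦ (q.1 : subgroupH1 ⊤ M)) hab
    exact Finite.of_injective j hj
  -- the range embeds in `(Z.map loc_v) × ∏_{w ∈ T} H¹(D_w, M)`
  haveI : ∀ w : ↥T, Finite (subgroupH1 (⊤ ⊓ decomp (w : HeightOneSpectrum (𝓞 K))) M) := fun w ↦ hfinT w w.2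
  have hrange : Finite Φ.range := by
    let j : Φ.range → (Z.map (resOfLe M (inf_le_left : ⊤ ⊓ decomp v ≤ ⊤))) ×
        ((w : ↥T) → subgroupH1 (⊤ ⊓ decomp (w : HeightOneSpectrum (𝓞 K))) M) :=
      fun q ↦ (⟨q.1.1, by
        obtain ⟨z, hz⟩ := q.2
        exact ⟨z, z.2, by rw [← hz]; rfl⟩⟩, q.1.2)
    have hj : Function.Injective j := by
      intro a b hab
      apply Subtype.ext
      have h1 := congrArg (fun q ↦ ((q.1 : subgroupH1 (⊤ ⊓ decomp v) M))) hab
      have h2 := congrArg Prod.snd hab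
      exact Prod.ext h1 h2
    exact Finite.of_injective j hj
  -- `Z / ker ≃ range`
  have hquot : Finite (↥Z ⧸ Φ.ker) := Finite.of_equiv _ (QuotientAddGroup.quotientKerEquivRange Φ).symm.toEquiv
  have hcard : Nat.card ↥Z = Nat.card (↥Z ⧸ Φ.ker) * Nat.card Φ.ker := Φ.ker.card_eq_card_quotient_mul_card_addSubgroup
  have hne : Nat.card ↥Z ≠ 0 := by
    rw [hcard]; exact mul_ne_zero (Nat.card_pos.ne') (Nat.card_pos.ne')
  exact Nat.finite_of_card_ne_zero hne

/-- **THE UNIFORM BOUND.** For `Z ≤ H¹(Γ_K, M)` vanishing at the finite `w ∤ p` off `T` and at `∞`: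
**`#Z ≤ #𝔖_v(K, M) · #(Z.map loc_v) · ∏_{w ∈ T} #H¹(D_w, M)`** (`𝔖_v(K,M) = restrictedSelmerBase M p v`). On the S3c frame with `M = W*′`
this bounds the dual-side group of (F3) by `2^{M+1} · B` uniformly in the level (memo F3-GLOBAL-w2g11 §2).
[cite: Agboola2007, §6 Prop. 6.10–6.11] [cite: MilneADT2006, I Thm. 4.10] -/
theorem natCard_le_of_restrictedSelmerBase_of_map
    (hT : ∀ z ∈ Z, ∀ w : HeightOneSpectrum (𝓞 K), ((p : ℕ) : 𝓞 K) ∉ w.asIdeal → w ∉ T →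
      resOfLe M (inf_le_left : ⊤ ⊓ decomp w ≤ ⊤) z = 0)
    (hinf : ∀ z ∈ Z, ∀ w : InfinitePlace K, resOfLe M (inf_le_left : ⊤ ⊓ decompInf w ≤ ⊤) z = 0)
    [Finite (restrictedSelmerBase M p v)]
    [Finite (Z.map (resOfLe M (inf_le_left : ⊤ ⊓ decomp v ≤ ⊤)))]
    (hfinT : ∀ w ∈ T, Finite (subgroupH1 (⊤ ⊓ decomp w) M)) :
    Nat.card ↥Z ≤ Nat.card (restrictedSelmerBase M p v) *
      Nat.card (Z.map (resOfLe M (inf_le_left : ⊤ ⊓ decomp v ≤ ⊤))) *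
      ∏ w ∈ T, Nat.card (subgroupH1 (⊤ ⊓ decomp w) M) := by
  set Φ : ↥Z →+ subgroupH1 (⊤ ⊓ decomp v) M ×
      ((w : ↥T) → subgroupH1 (⊤ ⊓ decomp (w : HeightOneSpectrum (𝓞 K))) M) :=
    AddMonoidHom.prod ((resOfLe M (inf_le_left : ⊤ ⊓ decomp v ≤ ⊤)).comp Z.subtype)
      (AddMonoidHom.pi fun w : ↥T ↦
        (resOfLe M (inf_le_left : ⊤ ⊓ decomp (w : HeightOneSpectrum (𝓞 K)) ≤ ⊤)).comp Z.subtype) with hΦ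
  haveI : ∀ w : ↥T, Finite (subgroupH1 (⊤ ⊓ decomp (w : HeightOneSpectrum (𝓞 K))) M) := fun w ↦ hfinT w w.2
  -- kernel bound
  have hker : Nat.card Φ.ker ≤ Nat.card (restrictedSelmerBase M p v) := by
    let j : Φ.ker → restrictedSelmerBase M p v := fun z ↦ ⟨((z : ↥Z) : subgroupH1 ⊤ M), by
      have hz0 : Φ (z : ↥Z) = 0 := (AddMonoidHom.mem_ker).mp z.2
      refine mem_restrictedSelmerBase_of_probe_eq_zero M p v T Z hT hinf (z : ↥Z).2 ?_ (fun w hw ↦ ?_)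
      · exact congrArg Prod.fst hz0
      · exact congrArg (fun q ↦ q.2 ⟨w, hw⟩) hz0⟩
    have hj : Function.Injective j := by
      intro a b hab
      apply Subtype.ext; apply Subtype.ext
      exact congrArg (fun q : ↥(restrictedSelmerBase M p v) ↦ (q.1 : subgroupH1 ⊤ M)) hab
    exact Nat.card_le_card_of_injective j hj
  -- range bound
  have hrange : Nat.card Φ.range ≤ Nat.card (Z.map (resOfLe M (inf_le_left : ⊤ ⊓ decomp v ≤ ⊤))) *
      ∏ w ∈ T, Nat.card (subgroupH1 (⊤ ⊓ decomp w) M) := by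
    let j : Φ.range → (Z.map (resOfLe M (inf_le_left : ⊤ ⊓ decomp v ≤ ⊤))) ×
        ((w : ↥T) → subgroupH1 (⊤ ⊓ decomp (w : HeightOneSpectrum (𝓞 K))) M) :=
      fun q ↦ (⟨q.1.1, by
        obtain ⟨z, hz⟩ := q.2
        exact ⟨z, z.2, by rw [← hz]; rfl⟩⟩, q.1.2)
    have hj : Function.Injective j := by
      intro a b hab
      apply Subtype.ext
      have h1 := congrArg (fun q ↦ ((q.1 : subgroupH1 (⊤ ⊓ decomp v) M))) hab
      have h2 := congrArg Prod.snd hab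
      exact Prod.ext h1 h2
    calc Nat.card Φ.range ≤ Nat.card ((Z.map (resOfLe M (inf_le_left : ⊤ ⊓ decomp v ≤ ⊤))) ×
          ((w : ↥T) → subgroupH1 (⊤ ⊓ decomp (w : HeightOneSpectrum (𝓞 K))) M)) :=
          Nat.card_le_card_of_injective j hj
      _ = _ := by
        rw [Nat.card_prod, Nat.card_pi, Finset.prod_coe_sort T (fun w ↦ Nat.card (subgroupH1 (⊤ ⊓ decomp w) M))]
  -- `#Z = #(Z/ker) · #ker = #range · #ker`
  have hcard : Nat.card ↥Z = Nat.card Φ.range * Nat.card Φ.ker := by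
    rw [Φ.ker.card_eq_card_quotient_mul_card_addSubgroup,
      Nat.card_congr (QuotientAddGroup.quotientKerEquivRange Φ).toEquiv]
  rw [hcard]
  calc Nat.card Φ.range * Nat.card Φ.ker
      ≤ (Nat.card (Z.map (resOfLe M (inf_le_left : ⊤ ⊓ decomp v ≤ ⊤))) * ∏ w ∈ T, Nat.card (subgroupH1 (⊤ ⊓ decomp w) M)) *
          Nat.card (restrictedSelmerBase M p v) := Nat.mul_le_mul hrange hker
    _ = _ := by ring

end Bound

end Summit.BirchSwinnertonDyer.BirchSwinnertonDyer.Theorems.PrintCf2.RestrictedSelmerPair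

end
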